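import Mathlib
import Literature.NumberTheory.Transcendental.LandauDefectLatticeTate

/-!
# Crux `InverseLandauRationalCurves` (item stmt-KontsevichZagierPeriods-13872), line `Sketch` —
# transport from one splitting extension to every algebraically closed field

For a Tate family `T = P/Q` over `k` (`F = T.toRatFunc ∈ k(ϖ)(z)`), the conclusion of the crux over
a field `L ⊇ k(ϖ)` reads: there are `A, B ∈ L[z]` with `B(0), B(1) ≠ 0`, `A(1) B(0) = A(0) B(1)`,
constants `c_q ∈ L` and exponent vectors `n_q ∈ ℤ^{poles of F in L}` which are EXACT multiplicative
relations among the Landau functions `g_p = (p - 1)/p`, such that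
`F = (A/B)′ + Σ_q c_q Σ_p n_{q,p}/(z - p)` in `L(z)`.

`stub_transport`: if this holds over some algebraic extension `K′ ⊇ k(ϖ)` in which the reduced
denominator of `F` splits, then it holds over every algebraically closed `K ⊇ k(ϖ)`. Proof: embed
`j : K′ → K` over `k(ϖ)` (`IsAlgClosed.lift`); `j` restricts to a bijection between the pole sets
(`Polynomial.Splits.image_rootSet`); push `A, B, c_q` forward along `j` and the exponent vectors
along the bijection (`g_{j p} = j (g_p)`, so exact relations are preserved); finally apply the ring
homomorphism `K′(z) → K(z)` induced by `j` (`RatFunc.liftRingHom`) to the identity.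
-/

noncomputable section

open Polynomial
open Literature.NumberTheory.Transcendental.AyoubRel

namespace Summit.KontsevichZagierPeriods.InverseLandau.RationalCurves

/-- Landau units commute with field embeddings: `g_{j p} = j (g_p)` (including the junk values at
`p ∈ {0, 1}`, which `j` preserves and reflects). -/
theorem landauUnit_map {K' K F : Type*} [Field K'] [Field K] [FunLike F K' K]
    [RingHomClass F K' K] (j : F) (p : K') :
    landauUnit K (j p) = Units.map (j : K' →* K) (landauUnit K' p) := by
  by_cases h : p ≠ 0 ∧ p ≠ 1
  · have h0 : j p ≠ 0 := (_root_.map_ne_zero j).2 h.1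
    have h1 : j p ≠ 1 := fun h1 =>
      h.2 (sub_eq_zero.1 ((map_eq_zero j).1 (by rw [map_sub, map_one, h1, sub_self])))
    ext
    rw [val_landauUnit K h0 h1, Units.coe_map, val_landauUnit K' h.1 h.2, MonoidHom.coe_coe,
      map_div₀, map_sub, map_one]
  · have h' : ¬(j p ≠ 0 ∧ j p ≠ 1) := by
      rintro ⟨h0, h1⟩
      exact h ⟨fun hp => h0 (by rw [hp, map_zero]), fun hp => h1 (by rw [hp, map_one])⟩
    rw [landauUnit, dif_neg h', landauUnit, dif_neg h, map_one]

/-- Monomials of Landau data transport along a bijection of pole sets induced by a field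
embedding: if `e : ι′ ≃ ι` and `Δ (e α) = j (Δ′ α)`, then `Δ^{n ∘ e⁻¹} = j (Δ′^n)`. -/
theorem monomial_comp_equiv_symm {K' K : Type*} [Field K'] [Field K] {ι' ι : Type*} [Fintype ι']
    [Fintype ι] (f : K' →* K) (Δ' : ι' → K'ˣ) (Δ : ι → Kˣ) (e : ι' ≃ ι)
    (hΔ : ∀ α, Δ (e α) = Units.map f (Δ' α)) (n : ι' → ℤ) :
    Landau.monomial Δ (fun β => n (e.symm β)) = Units.map f (Landau.monomial Δ' n) := by
  rw [← Landau.monomial_map]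
  unfold Landau.monomial
  exact (Fintype.prod_equiv e _ _ fun α => by simp only [Equiv.symm_apply_apply, hΔ]).symm

/-- **Transport.** If the conclusion of the crux holds over some algebraic extension `K′` of
`k(ϖ)` in which the reduced denominator of `F` splits, it holds over every algebraically closed
`K ⊇ k(ϖ)`: embed `K′ → K` over `k(ϖ)` (`IsAlgClosed.lift`), map `A, B, c_q`, transport the
exponent vectors along the bijection of pole sets, and map the identity of rational functions. -/
theorem stub_transport {k : Type} [Field k] [CharZero k] (T : TateFamily₁ k)
    (K' : Type) [Field K'] [Algebra (RatFunc k) K'] [Algebra.IsAlgebraic (RatFunc k) K']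
    (hsplit : (T.toRatFunc.denom.map (algebraMap (RatFunc k) K')).Splits)
    (h : ∃ (A B : Polynomial K') (s : ℕ) (c : Fin s → K')
        (nv : Fin s → (landauSet K' T.toRatFunc → ℤ)),
      B.eval 0 ≠ 0 ∧ B.eval 1 ≠ 0 ∧ A.eval 1 * B.eval 0 = A.eval 0 * B.eval 1 ∧
      (∀ q, nv q ∈ Landau.relationLattice (landauDatum K' T.toRatFunc)) ∧
      algebraMap (Polynomial K') (RatFunc K')
          ((TateFamily₁.toParamPoly T.P).map (algebraMap (RatFunc k) K')) /
        algebraMap (Polynomial K') (RatFunc K')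
          ((TateFamily₁.toParamPoly T.Q).map (algebraMap (RatFunc k) K')) =
      algebraMap (Polynomial K') (RatFunc K') (derivative A * B - A * derivative B) /
        algebraMap (Polynomial K') (RatFunc K') (B ^ 2) +
      ∑ q, RatFunc.C (c q) * ∑ p : landauSet K' T.toRatFunc,
        RatFunc.C ((nv q p : ℤ) : K') * (RatFunc.X - RatFunc.C (p : K'))⁻¹)
    (K : Type) [Field K] [IsAlgClosed K] [Algebra (RatFunc k) K] :
    ∃ (A B : Polynomial K) (s : ℕ) (c : Fin s → K)
        (nv : Fin s → (landauSet K T.toRatFunc → ℤ)),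
      B.eval 0 ≠ 0 ∧ B.eval 1 ≠ 0 ∧ A.eval 1 * B.eval 0 = A.eval 0 * B.eval 1 ∧
      (∀ q, nv q ∈ Landau.relationLattice (landauDatum K T.toRatFunc)) ∧
      algebraMap (Polynomial K) (RatFunc K)
          ((TateFamily₁.toParamPoly T.P).map (algebraMap (RatFunc k) K)) /
        algebraMap (Polynomial K) (RatFunc K)
          ((TateFamily₁.toParamPoly T.Q).map (algebraMap (RatFunc k) K)) =
      algebraMap (Polynomial K) (RatFunc K) (derivative A * B - A * derivative B) /
        algebraMap (Polynomial K) (RatFunc K) (B ^ 2) +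
      ∑ q, RatFunc.C (c q) * ∑ p : landauSet K T.toRatFunc,
        RatFunc.C ((nv q p : ℤ) : K) * (RatFunc.X - RatFunc.C (p : K))⁻¹ := by
  obtain ⟨A, B, s, c, nv, hB0, hB1, hAB, hnv, hid⟩ := h
  -- an embedding `j : K' → K` over `k(ϖ)`
  let j : K' →ₐ[RatFunc k] K := IsAlgClosed.lift
  have hjcomp : (j : K' →+* K).comp (algebraMap (RatFunc k) K') = algebraMap (RatFunc k) K :=
    j.comp_algebraMap
  -- (1) `j` restricts to a bijection of the pole sets
  obtain ⟨e, he⟩ : ∃ e : landauSet K' T.toRatFunc ≃ landauSet K T.toRatFunc,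
      ∀ p, ((e p : landauSet K T.toRatFunc) : K) = j (p : K') := by
    have himg : (j : K' → K) '' landauSet K' T.toRatFunc = landauSet K T.toRatFunc :=
      hsplit.image_rootSet j
    have hmaps : Set.MapsTo (j : K' → K) (landauSet K' T.toRatFunc) (landauSet K T.toRatFunc) :=
      fun x hx => himg ▸ Set.mem_image_of_mem _ hx
    refine ⟨Equiv.ofBijective (hmaps.restrict _ _ _) ⟨hmaps.restrict_inj.2 ?_,
      hmaps.restrict_surjective_iff.2 fun y hy => ?_⟩, fun p => rfl⟩
    · exact j.toRingHom.injective.injOn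
    · rwa [← himg] at hy
  -- (2) the Landau data correspond along `e`: `g_{j p} = j (g_p)`
  have hdatum : ∀ α, landauDatum K T.toRatFunc (e α) =
      Units.map (j : K' →* K) (landauDatum K' T.toRatFunc α) := fun α => by
    show landauUnit K ((e α : landauSet K T.toRatFunc) : K) = _
    rw [he]
    exact landauUnit_map j (α : K')
  -- (3) the ring homomorphism `ψ : K'(z) → K(z)` induced by `j`, applied to the identity
  obtain ⟨ψ, hψ⟩ : ∃ ψ : RatFunc K' →+* RatFunc K, ∀ p : K'[X],
      ψ (algebraMap K'[X] (RatFunc K') p) = algebraMap K[X] (RatFunc K) (p.map (j : K' →+* K)) := by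
    let φ : K'[X] →+* RatFunc K := (algebraMap K[X] (RatFunc K)).comp (mapRingHom (j : K' →+* K))
    have hφ : Function.Injective φ := (RatFunc.algebraMap_injective K).comp
      (Polynomial.map_injective (j : K' →+* K) (j : K' →+* K).injective)
    exact ⟨RatFunc.liftRingHom φ (nonZeroDivisors_le_comap_nonZeroDivisors_of_injective φ hφ),
      fun p => RatFunc.liftRingHom_algebraMap _ _ p⟩
  have hψC : ∀ a : K', ψ (RatFunc.C a) = RatFunc.C (j a) := fun a => by
    rw [← RatFunc.algebraMap_C, hψ, Polynomial.map_C]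
    rfl
  have hψX : ψ RatFunc.X = RatFunc.X := by
    show ψ (algebraMap K'[X] (RatFunc K') Polynomial.X) = _
    rw [hψ, Polynomial.map_X]
    rfl
  have hjint : ∀ n : ℤ, j (n : K') = (n : K) := fun n => map_intCast j n
  have hid' := congr_arg ψ hid
  rw [map_div₀ ψ, map_add ψ, map_div₀ ψ, hψ, hψ, hψ, hψ, Polynomial.map_map, Polynomial.map_map,
    hjcomp, map_sum ψ] at hid'
  simp only [map_mul ψ, map_sum ψ, map_inv₀ ψ, map_sub ψ, hψC, hψX, hjint, Polynomial.map_sub,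
    Polynomial.map_mul, ← Polynomial.derivative_map, Polynomial.map_pow] at hid'
  refine ⟨A.map (j : K' →+* K), B.map (j : K' →+* K), s, fun q => j (c q),
    fun q p => nv q (e.symm p), ?_, ?_, ?_, fun q => ?_, ?_⟩
  · -- `B(0) ≠ 0`
    rw [Polynomial.eval_zero_map]
    exact (_root_.map_ne_zero (j : K' →+* K)).2 hB0
  · -- `B(1) ≠ 0`
    rw [Polynomial.eval_one_map]
    exact (_root_.map_ne_zero (j : K' →+* K)).2 hB1
  · -- `A(1) B(0) = A(0) B(1)`
    rw [Polynomial.eval_zero_map, Polynomial.eval_zero_map, Polynomial.eval_one_map,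
      Polynomial.eval_one_map, ← map_mul, ← map_mul, hAB]
  · -- exact relations are preserved: `Δ^{n ∘ e⁻¹} = j (Δ′^n) = j 1 = 1`
    rw [Landau.mem_relationLattice, monomial_comp_equiv_symm (j : K' →* K) _ _ e hdatum,
      Landau.mem_relationLattice.1 (hnv q), map_one]
  · -- the mapped identity, with the inner sums reindexed along `e`
    refine hid'.trans ?_
    congr 1
    refine Fintype.sum_congr _ _ fun q => ?_
    congr 1
    exact Fintype.sum_equiv e _ _ fun p => by simp only [Equiv.symm_apply_apply, he]

end Summit.KontsevichZagierPeriods.InverseLandau.RationalCurves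

end
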